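import Summits.QuantumFields.YangMills.Theorems.AlphaInputsT3ACv3StartShell
import Summits.QuantumFields.YangMills.Theorems.AlphaInputsT3ACv3StartTwoCellSat
import Summits.QuantumFields.YangMills.Theorems.AlphaInputsT3ACv3AdaptedClassX
import Summits.QuantumFields.YangMills.Theorems.AlphaInputsT3ACHistories
import HarnessLib

/-!
# `AlphaInputsT3ACv3StartShellSat` — START v3.1 for the (FL) `hLift` binder, row (S5)-4 knit: **SHELL PLAQUETTES ARE CONSTRAINED** (the `hC` row of ★w2 g2's `hbox_startSys`∕
# `hcov_startSys` at the shell predicate) — every corner of a shell plaquette of an interior-vertex cube lies in one of the eight cells around the vertex, hence in Ω under level-`k`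
# saturation (`shellPlaq_mem_plaqsIn`); plus the level-`(k+1)` saturation row `hsat1` of `hbox_startSys` at `Ω_{k+1}(h)` (`omega_sat1`) — lane `pub-balaban3d` ∕ cell `ym3-torus`,
# seat `ym-ust-19936-w1` (g2, LEAD)

WHY (PROGRESS 8: discharging the seven lattice binders of `startT3_cert` from ★w2's∕★w5's lattice theorems).
WHAT IS HERE: `iterBlockOf_apply_of_eq_cast`, ★`iterBlockOf_boxSite_vertexSite` (the cell of a vertex-chart point with coordinates in `[−(L^k−1), L^k]`), ★★`shellPlaq_mem_plaqsIn`,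
`omega_sat1`.
HONEST FRAMING.  Lattice bookkeeping; (FL)∕`hLift` NOT proved; count-neutral helper toward R3 2′ (items 19936∕19935); registry untouched; nothing about d = 4, the continuum, or a mass
gap; YM₃ on T³ is rung R3, not Clay.

References: T. Bałaban, Commun. Math. Phys. 109 (1987) 249–301 [Balaban1987RG1] ((0.1) p.251); Commun. Math. Phys. 102 (1985) 255–275 [Balaban1985UV3] ((38)–(39) p.266).
-/

set_option autoImplicit false

noncomputable section

namespace Summit.QuantumFields.YangMills.Theorems.TubeStart

open Literature.MathematicalPhysics.QuantumFieldTheory.Balaban1983to89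
open Literature.MathematicalPhysics.QuantumFieldTheory.Balaban1983to89.B5Eq118OneStroke (iterBlockOf val_iterBlockOf)
open Literature.MathematicalPhysics.QuantumFieldTheory.Balaban1983to89.B10Eq38TorusDomains (toFine plaqsIn cornerSet mem_plaqsIn_iff)
open Summit.QuantumFields.Balaban3D.Carriers
open Summit.QuantumFields.YangMills.Theorems.ModelBox

variable {P : Params} {k : ℕ} (hk : k ≤ P.m + P.K)
include hk

/-- **THE BLOCK LABEL OF A PRESENTED COORDINATE**: if `x_i = a·L^k + s` with `s < L^k` then `(iterBlockOf k x)_i = a` in `ZMod N_k`. [cite: Balaban1987RG1, (0.1) p.251] -/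
theorem iterBlockOf_apply_of_eq_cast (x : Site P 0) (i : Fin P.d) {a s : ℕ} (hs : s < P.L ^ k) (hx : x i = (((a * P.L ^ k + s) : ℕ) : ZMod (P.sitesPerDir 0))) :
    iterBlockOf k x i = ((a : ℕ) : ZMod (P.sitesPerDir k)) := by
  obtain ⟨-, hdiv⟩ := val_mod_div_of_eq_cast hk hs hx
  have hval : (iterBlockOf k x i).val = (x i).val / P.L ^ k := val_iterBlockOf k hk x i
  have hlt : (x i).val / P.L ^ k < P.sitesPerDir k := by rw [← hval]; exact ZMod.val_lt _
  rw [Nat.mod_eq_of_lt hlt] at hdiv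
  calc iterBlockOf k x i = (((iterBlockOf k x i).val : ℕ) : ZMod (P.sitesPerDir k)) := (ZMod.natCast_zmod_val _).symm
    _ = (((a % P.sitesPerDir k) : ℕ) : ZMod (P.sitesPerDir k)) := by rw [hval, hdiv]
    _ = ((a : ℕ) : ZMod (P.sitesPerDir k)) := by rw [ZMod.natCast_mod]

/-- **★ THE CELL OF A VERTEX-CHART POINT**: for coordinates `−(L^k − 1) ≤ c_i ≤ L^k`, the site `boxSite (vertexSite k y) c` lies in the cell `shiftBy y (1 ≤ c_i)`. [cite: Balaban1987RG1, (0.1) p.251] -/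
theorem iterBlockOf_boxSite_vertexSite (y : Site P k) {c : Fin P.d → ℤ} (hc : ∀ i, -((P.L ^ k - 1 : ℕ) : ℤ) ≤ c i ∧ c i ≤ (P.L ^ k : ℕ)) :
    iterBlockOf k (boxSite (vertexSite k y) c) = shiftBy y (fun i => decide (1 ≤ c i)) := by
  have hL1 : 1 ≤ P.L ^ k := Nat.one_le_pow _ _ P.L_pos
  funext i
  obtain ⟨hlo, hhi⟩ := hc i
  simp only [shiftBy]
  by_cases h1 : 1 ≤ c i
  · -- the next cell: `x_i = (y_i + 1)·L^k + t`, `c_i = t + 1`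
    simp only [decide_eq_true_eq]
    rw [if_pos h1]
    obtain ⟨t, ht⟩ : ∃ t : ℕ, c i = (t : ℤ) + 1 := ⟨(c i - 1).toNat, by rw [Int.toNat_of_nonneg (by omega)]; ring⟩
    have htL : t < P.L ^ k := by
      have h' : (t : ℤ) + 1 ≤ ((P.L ^ k : ℕ) : ℤ) := by rw [ht] at hhi; exact hhi
      have h'' : t + 1 ≤ P.L ^ k := by exact_mod_cast h'
      omega
    have hx : boxSite (vertexSite k y) c i = (((((y i).val + 1) * P.L ^ k + t) : ℕ) : ZMod (P.sitesPerDir 0)) := by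
      simp only [boxSite, vertexSite_apply, ht]
      have h3 : (((y i).val + 1) * P.L ^ k + t : ℕ) = ((y i).val * P.L ^ k + (P.L ^ k - 1)) + (t + 1) := by zify [hL1]; ring
      rw [h3]; push_cast; ring
    rw [iterBlockOf_apply_of_eq_cast hk _ i htL hx]
    push_cast; rw [ZMod.natCast_zmod_val]
  · -- the same cell: `x_i = y_i·L^k + (L^k − 1 − t)`, `c_i = −t`
    simp only [decide_eq_true_eq]
    rw [if_neg h1, add_zero]
    obtain ⟨t, ht⟩ : ∃ t : ℕ, c i = -(t : ℤ) := ⟨(-c i).toNat, by rw [Int.toNat_of_nonneg (by omega)]; ring⟩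
    have htle : t ≤ P.L ^ k - 1 := by
      have h' : (t : ℤ) ≤ ((P.L ^ k - 1 : ℕ) : ℤ) := by rw [ht] at hlo; linarith
      exact_mod_cast h'
    have hx : boxSite (vertexSite k y) c i = ((((y i).val * P.L ^ k + (P.L ^ k - 1 - t)) : ℕ) : ZMod (P.sitesPerDir 0)) := by
      simp only [boxSite, vertexSite_apply, ht]
      push_cast [Nat.cast_sub htle, Nat.cast_sub hL1]
      ring
    rw [iterBlockOf_apply_of_eq_cast hk _ i (s := P.L ^ k - 1 - t) (by omega) hx, ZMod.natCast_zmod_val]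

/-- **★★ SHELL PLAQUETTES ARE CONSTRAINED**: under level-`k` saturation, every shell plaquette of an interior-vertex cube (`RbT + 2 ≤ L^k`) has its four corners in Ω.
[cite: Balaban1985UV3, (39) p.266] -/
theorem shellPlaq_mem_plaqsIn {Ω : Set (Site P 0)} (hsat : ∀ x : Site P 0, x ∈ Ω ↔ toFine k (iterBlockOf k x) ∈ Ω) (hRL : RbT P k + 2 ≤ P.L ^ k) (q : Plaq P 0)
    (hq : ShellPlaq k Ω q) : q ∈ plaqsIn 0 Ω := by
  classical
  obtain ⟨y, u, hy, ⟨⟨h1, h2, h3, h4⟩, -⟩, hsrc⟩ := hq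
  -- every corner `boxSite (vertexSite k y) c` with `|c| ≤ RbT + 1`-ish is in Ω
  have hin : ∀ c : Fin P.d → ℤ, InBox (RbT P k) c → boxSite (vertexSite k y) c ∈ Ω := by
    intro c hc
    have hc' : ∀ i, -((P.L ^ k - 1 : ℕ) : ℤ) ≤ c i ∧ c i ≤ (P.L ^ k : ℕ) := by
      intro i
      obtain ⟨hl, hh⟩ := hc.bounds i
      have : (RbT P k : ℤ) + 2 ≤ (P.L ^ k : ℕ) := by exact_mod_cast hRL
      have h1' : ((P.L ^ k - 1 : ℕ) : ℤ) = (P.L ^ k : ℕ) - 1 := by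
        have := Nat.one_le_pow k P.L P.L_pos; push_cast [Nat.cast_sub this]; ring
      constructor <;> [rw [h1']; skip] <;> linarith
    rw [hsat, iterBlockOf_boxSite_vertexSite hk y hc']
    exact hy _
  rw [mem_plaqsIn_iff]
  simp only [cornerSet, Set.insert_subset_iff, Set.singleton_subset_iff, B10Eq38TorusDomains.toFine_zero]
  rw [hsrc, ← boxSite_add_e, ← boxSite_add_e, ← boxSite_add_e]
  exact ⟨hin _ h1, hin _ h2, hin _ h3, hin _ (by rw [add_e_comm] at h4 ⊢; exact h4)⟩

omit hk in
/-- **`hsat1` AT `Ω_{k+1}(h)`**: two `k`-cells of the same `(k+1)`-block are in Ω together. [cite: Balaban1985UV3, (39) p.266] -/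
theorem omega_sat1 (M₁ : ℕ) (Rcol : ℕ → ℕ) (hk : k ≤ P.m + P.K) (h : Hist P (k + 1)) :
    ∀ z z' : Site P k, blockOf z = blockOf z' → (CellIn (Omega M₁ Rcol (k + 1) h (k + 1)) k z ↔ CellIn (Omega M₁ Rcol (k + 1) h (k + 1)) k z') := by
  intro z z' hzz
  refine mem_Omega_iff_of_coarsen_eq M₁ Rcol h (j' := k + 1) le_rfl le_rfl ?_
  rw [coarsen_succ, coarsen_succ, coarsen_toFine k hk, coarsen_toFine k hk, hzz]

end Summit.QuantumFields.YangMills.Theorems.TubeStart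

end
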